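import Mathlib.NumberTheory.NumberField.InfinitePlace.Embeddings
import Mathlib.Order.SymmDiff
import Literature.AlgebraicGeometry.Motives.WeilTypeCM
import HarnessLib

/-!
# Elementary operations on CM types: conjugate type, the pair of embeddings over a place, flip at
# a place

Small [folklore] API over the tree's `Literature.AlgebraicGeometry.Motives.CMType K`
(`= {Φ : Set (K →+* ℂ) // ∀ φ, φ ∈ Φ ↔ φ̄ ∉ Φ}`, Shimura–Taniyama; Milne, *Complex Multiplication*,
§1), used by the Literature modules on CM points of Picard modular surfaces
(`Literature/NumberTheory/Rogawski1990/`) and by the rank-four-face combinatorics of CM types: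

* `mem_iff_conjugate_notMem`, `conjugate_mem_iff_notMem` — the two membership forms of the CM-type
  axiom;
* `bar Φ` — the conjugate CM type `Φ̄ = {φ̄ : φ ∈ Φ}`, as a set the complement of `Φ`;
* `placeSet p = {p, p̄}` — the two complex embeddings over the infinite place of `p`, and its
  stability under conjugation;
* `flip p Φ = Φ ∆ {p, p̄}` — `Φ` with its element over the place of `p` replaced by the other one
  (again a CM type).

Everything is a definition or a one-line consequence of the CM-type axiom; no number-field
hypothesis is needed (`[Field K]` only, as for `CMType`).  NOT here: reflex fields and induced
types (`Literature/NumberTheory/ComplexMultiplication/{ReflexType, InducedCMType}.lean`), CM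
types of abelian varieties (`Motives/WeilTypeCM.lean`).

## References

* J. S. Milne, *Complex Multiplication* (course notes), §1 (CM types, `Φ ⊔ Φ̄ = Hom(K, ℂ)`).
  [folklore]
-/

noncomputable section

open NumberField NumberField.ComplexEmbedding
open scoped symmDiff

namespace Literature.NumberTheory.ComplexMultiplication

open Literature.AlgebraicGeometry.Motives (CMType)

namespace CMTypeOps

variable {K : Type*} [Field K]

/-- Membership form of the CM-type axiom: `φ ∈ Φ ↔ φ̄ ∉ Φ`. [folklore] -/
theorem mem_iff_conjugate_notMem (Φ : CMType K) (φ : K →+* ℂ) : φ ∈ Φ.1 ↔ conjugate φ ∉ Φ.1 :=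
  Φ.2 φ

/-- The CM-type axiom read at `φ̄`: `φ̄ ∈ Φ ↔ φ ∉ Φ`. [folklore] -/
theorem conjugate_mem_iff_notMem (Φ : CMType K) (φ : K →+* ℂ) :
    conjugate φ ∈ Φ.1 ↔ φ ∉ Φ.1 := by
  have h := Φ.2 (conjugate φ)
  rw [show conjugate (conjugate φ) = φ from involutive_conjugate K φ] at h
  constructor
  · intro hc hφ
    exact (h.mp hc) hφ
  · intro hφ
    by_contra hc
    exact ((Φ.2 φ).not.mp hφ) (by simpa using hc)

/-- The conjugate CM type `Φ̄ = {φ̄ : φ ∈ Φ}`; as a set it is the complement of `Φ`. [folklore] -/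
def bar (Φ : CMType K) : CMType K :=
  ⟨Φ.1ᶜ, fun φ => by
    simp only [Set.mem_compl_iff, not_not]
    exact (conjugate_mem_iff_notMem Φ φ).symm⟩

/-- Membership in the conjugate type. [folklore] -/
@[simp] theorem mem_bar_iff (Φ : CMType K) (φ : K →+* ℂ) : φ ∈ (bar Φ).1 ↔ φ ∉ Φ.1 := Iff.rfl

/-- The orbit `{p, p̄}` of an embedding under complex conjugation = the complex embeddings over its
infinite place, as a set of embeddings. [folklore] -/
def placeSet (p : K →+* ℂ) : Set (K →+* ℂ) := {p, conjugate p}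

/-- `placeSet p` is stable under conjugation. [folklore] -/
theorem conjugate_mem_placeSet_iff (p φ : K →+* ℂ) :
    conjugate φ ∈ placeSet p ↔ φ ∈ placeSet p := by
  simp only [placeSet, Set.mem_insert_iff, Set.mem_singleton_iff]
  constructor
  · rintro (h | h)
    · right; rw [← h, involutive_conjugate K φ]
    · left; exact (involutive_conjugate K).injective h
  · rintro (h | h)
    · right; rw [h]
    · left; rw [h, involutive_conjugate K p]

/-- A CM type contains exactly one of `p`, `p̄`: `p ∈ Φ` or `p̄ ∈ Φ`. [folklore] -/
theorem mem_or_conjugate_mem (Φ : CMType K) (p : K →+* ℂ) : p ∈ Φ.1 ∨ conjugate p ∈ Φ.1 := by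
  by_cases h : p ∈ Φ.1
  · exact Or.inl h
  · exact Or.inr ((conjugate_mem_iff_notMem Φ p).mpr h)

/-- `Φ^{(p)}`: the CM type `Φ` with its element at the place of `p` replaced by the other one, i.e.
the symmetric difference `Φ ∆ {p, p̄}`. [folklore] -/
def flip (p : K →+* ℂ) (Φ : CMType K) : CMType K :=
  ⟨Φ.1 ∆ placeSet p, fun φ => by
    have hΦ := mem_iff_conjugate_notMem Φ φ
    have hP := conjugate_mem_placeSet_iff p φ
    simp only [Set.mem_symmDiff]
    tauto⟩

/-- Membership in the flipped type. [folklore] -/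
theorem mem_flip_iff (p : K →+* ℂ) (Φ : CMType K) (φ : K →+* ℂ) :
    φ ∈ (flip p Φ).1 ↔ (φ ∈ Φ.1 ∧ φ ∉ placeSet p ∨ φ ∈ placeSet p ∧ φ ∉ Φ.1) := by
  simp [flip, Set.mem_symmDiff]

/-- Flipping twice at the same place gives back `Φ`. [folklore] -/
theorem flip_flip (p : K →+* ℂ) (Φ : CMType K) : flip p (flip p Φ) = Φ := by
  apply Subtype.ext
  simp [flip, symmDiff_symmDiff_cancel_right]

end CMTypeOps

end Literature.NumberTheory.ComplexMultiplication

end
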